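import Mathlib
import Summits.ValiantsHypothesis.ValiantsHypothesis.Theorems.DivisionGapZeroOneTransferFaceEngine
import Summits.ValiantsHypothesis.ValiantsHypothesis.Theorems.DivisionGapZeroOneTransferFaceIsolationForms
import Summits.ValiantsHypothesis.ValiantsHypothesis.Theorems.DivisionGapZeroOneTransferBrickZoneUnique
import Summits.ValiantsHypothesis.ValiantsHypothesis.Theorems.DivisionGapZeroOneTransferBrickWallTiling
import Summits.ValiantsHypothesis.ValiantsHypothesis.Theorems.DivisionGapZeroOneTransferRingCover

/-!
# Crux `DivisionGap.ZeroOneTransfer` (stmt-ValiantsHypothesis-5066), line `charged-uncharged`, Part E-I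
(lead c13): THE SQUARE-GRID PARTNER `Sq_n` IS NOT AN MM CERTIFICATE FOR `D_n`

The uncharged child `MonotoneMultiples` of the crux at the decisive instance `D_n = triPM n` asks for some
nonzero `X ≥ 0` with `L₊(D_n · X)` quasi-polynomial.  Lead c12's necessity theory (Parts D-I–D-IV) leaves
as simplest surviving candidate the SQUARE-GRID dimer polynomial `Sq_n = sqPM n` on the same vertices
(domino tilings; itself division-easy by urban renewal, item 5072) and asked its disprover for
`L₊(D_n · Sq_n)`.  This file settles it with NO square-grid gadgets:

* `sq_partner_lower_bound` — `∃ κ, ∀` even `n`, `m ≡ 0 (mod 4)`, `68 ≤ m`, `3m + 4 ≤ n`, `24L + 60 ≤ m-4`: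
  `T^L ≤ 4 · ((n²+2)(L₊(D_n · Sq_n) + 3))^κ · ((m-4)²+1)² · (T-1)^L` (`T = 6^44`), i.e. with `m ≈ n/3`
  `L₊(D_n · Sq_n) ≥ 2^{Ω(n)/κ} / poly(n)`.  Proof: the FREE TOP FORM of `D_n · Sq_n` along the indicator
  weight of the predicate `E0sq` ("triangular edge inside one brick-wall zone, or a domino of the explicit
  tiling `u₀`") is `D_n[E0sq] · x^{u₀}` — a finite piece of a brick wall is frozen (`stub_brickZone_unique`),
  `u₀` is a tiling extending the bricks (`stub_u0_isSqDimer`), top forms in indicator directions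
  (`stub_topComponent_wInd_triPM/sqPM`, `stub_sqPMIn_eq_monomial`); then the face engine `stub_faceEngine`
  (JSS contraction of `x^{u₀}`, block restriction to the block `[2, m-2) × [m+4, 2m)` of the first zone,
  whose complement is coverable inside `E0sq` by `stub_ringCover`, Valiant's bound for `D_{m-4}`).
* `not_qp_complexity_triPM_mul_sqPM` — asymptotic form: no `c` has `L₊(D_n · Sq_n) ≤ 2^((log₂ n + c)^c)`
  for all `n` (level `n = 2^(j+2)`, zone height `2^j + 4`, block `2^j`).
[cite: Valiant1980, §3 Thm 1] [cite: JuknaSeiwertSergeev2022, Lemma 2]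
-/

noncomputable section

-- `Summit.ValiantsHypothesis.ValiantsHypothesis.…` is the tree's mandated single-conjunct layout
-- (Sub = Summit), so the duplicated namespace component is intended.
set_option linter.dupNamespace false

namespace Summit.ValiantsHypothesis.ValiantsHypothesis.Theorems.DivisionGapZeroOneTransfer

open MvPolynomial
open Literature.Computability.AlgebraicComplexity
open Summit.ValiantsHypothesis.ValiantsHypothesis.Theorems.TriangularDimersDivisionEasy.Negative
open Summit.ValiantsHypothesis.ValiantsHypothesis.Theorems.ZeroOneTransfer
open FaceIsolation
open scoped NNReal BigOperators

namespace SqPartner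

variable {n : ℕ}

/-- On the zone, `u₀` is the brick partner (from `stub_u0_isSqDimer`'s agreement with the ℕ-recipe).
[folklore] -/
theorem u0_eq_brick_of_agree {m b : ℕ}
    (hval : ∀ v : Vtx n, ((u0 m b v).1 : ℕ) = (u0Nat m b ((v.1 : ℕ), (v.2 : ℕ))).1 ∧
      ((u0 m b v).2 : ℕ) = (u0Nat m b ((v.1 : ℕ), (v.2 : ℕ))).2) :
    ∀ v : Vtx n, InZone m b v → ((u0 m b v).1 : ℕ) = (brick m ((v.1 : ℕ), (v.2 : ℕ))).1 ∧
        ((u0 m b v).2 : ℕ) = (brick m ((v.1 : ℕ), (v.2 : ℕ))).2 := by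
  intro v hv
  obtain ⟨h1, h2⟩ := hval v
  have hz : inZoneNat m b ((v.1 : ℕ), (v.2 : ℕ)) := hv
  have hlt : ¬ 2 * m ≤ (v.1 : ℕ) := by have := hz.1; dsimp only at this; omega
  have hu : u0Nat m b ((v.1 : ℕ), (v.2 : ℕ)) = brick m ((v.1 : ℕ), (v.2 : ℕ)) := by
    unfold u0Nat; rw [if_neg hlt, if_pos hz]
  rw [h1, h2, hu]
  exact ⟨rfl, rfl⟩

/-- Exponent bookkeeping: `κ (2j + 7 + (j+2+c)^c) ≤ (j + (c+9+2κ))^(c+9+2κ)`. [folklore] -/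
theorem kappa_bound (κ j c : ℕ) :
    κ * (2 * j + 7 + (j + 2 + c) ^ c) ≤ (j + (c + 9 + 2 * κ)) ^ (c + 9 + 2 * κ) := by
  set B := j + (c + 9 + 2 * κ) with hB
  have hB9 : 9 ≤ B := by omega
  have h1 : 2 * j + 7 ≤ B ^ 2 := by nlinarith
  have h2 : (j + 2 + c) ^ c ≤ B ^ c := Nat.pow_le_pow_left (by omega) c
  have h3 : B ^ 2 ≤ B ^ (c + 2) := Nat.pow_le_pow_right (by omega) (by omega)
  have h4 : B ^ c ≤ B ^ (c + 2) := Nat.pow_le_pow_right (by omega) (by omega)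
  have h5 : 2 * j + 7 + (j + 2 + c) ^ c ≤ 2 * B ^ (c + 2) := by omega
  have h6 : 2 * κ ≤ B := by omega
  calc κ * (2 * j + 7 + (j + 2 + c) ^ c) ≤ κ * (2 * B ^ (c + 2)) := Nat.mul_le_mul_left _ h5
    _ = (2 * κ) * B ^ (c + 2) := by ring
    _ ≤ B * B ^ (c + 2) := Nat.mul_le_mul_right _ h6
    _ = B ^ (c + 3) := by ring
    _ ≤ B ^ (c + 9 + 2 * κ) := Nat.pow_le_pow_right (by omega) (by omega)

/-- From `L₊(D_n · Sq_n) ≤ 2^((log₂ n + c)^c)` at `n = 2^(j+2)`: the engine's quantity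
`((n²+2)(L₊ + 3))^κ` is at most `2^((j + c')^c')` with `c' = c + 9 + 2κ`. [folklore] -/
theorem engine_quantity_le {κ c j : ℕ}
    (h : complexity (triPM (2 ^ (j + 2)) * sqPM (2 ^ (j + 2))) ≤ bound c (2 ^ (j + 2))) :
    ((2 ^ (j + 2) * 2 ^ (j + 2) + 2) * (complexity (triPM (2 ^ (j + 2)) * sqPM (2 ^ (j + 2))) + 3)) ^ κ ≤
      2 ^ ((j + (c + 9 + 2 * κ)) ^ (c + 9 + 2 * κ)) := by
  have hlog : Nat.log 2 (2 ^ (j + 2)) = j + 2 := Nat.log_pow (by norm_num) _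
  unfold bound at h
  rw [hlog] at h
  have h1 : 2 ^ (j + 2) * 2 ^ (j + 2) + 2 ≤ 2 ^ (2 * j + 5) := by
    have e : 2 ^ (j + 2) * 2 ^ (j + 2) = 2 ^ (2 * j + 4) := by rw [← pow_add]; ring_nf
    have e2 : 2 ^ (2 * j + 5) = 2 ^ (2 * j + 4) * 2 := by rw [← pow_succ]
    have : 2 ≤ 2 ^ (2 * j + 4) := by
      calc 2 = 2 ^ 1 := by norm_num
        _ ≤ 2 ^ (2 * j + 4) := Nat.pow_le_pow_right (by norm_num) (by omega)
    rw [e, e2]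
    omega
  have h2 : complexity (triPM (2 ^ (j + 2)) * sqPM (2 ^ (j + 2))) + 3 ≤ 2 ^ ((j + 2 + c) ^ c + 2) := by
    have e3 : 2 ^ ((j + 2 + c) ^ c + 2) = 2 ^ ((j + 2 + c) ^ c) * 4 := by rw [pow_add]; norm_num
    have : 1 ≤ 2 ^ ((j + 2 + c) ^ c) := Nat.one_le_two_pow
    rw [e3]
    omega
  calc ((2 ^ (j + 2) * 2 ^ (j + 2) + 2) * (complexity (triPM (2 ^ (j + 2)) * sqPM (2 ^ (j + 2))) + 3)) ^ κ
      ≤ (2 ^ (2 * j + 5) * 2 ^ ((j + 2 + c) ^ c + 2)) ^ κ := Nat.pow_le_pow_left (Nat.mul_le_mul h1 h2) κ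
    _ = 2 ^ (κ * (2 * j + 7 + (j + 2 + c) ^ c)) := by
        rw [← pow_add, ← pow_mul]; congr 1; ring
    _ ≤ 2 ^ ((j + (c + 9 + 2 * κ)) ^ (c + 9 + 2 * κ)) :=
        Nat.pow_le_pow_right (by norm_num) (kappa_bound κ j c)

end SqPartner

open SqPartner

/-- **Rung E-I: THE SQUARE-GRID PARTNER IS NOT A CERTIFICATE.**  For even `n`, `m ≡ 0 (mod 4)`,
`68 ≤ m`, `3m + 4 ≤ n` and `24L + 60 ≤ m - 4`:
`T^L ≤ 4 · ((n²+2)(L₊(D_n · Sq_n) + 3))^κ · ((m-4)²+1)² · (T-1)^L` — with `m ≈ n/3` an exponential lower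
bound `L₊(D_n · Sq_n) ≥ 2^{Ω(n)/κ} / poly(n)`.  Free top form along the indicator weight of `E0sq m (m+2)`
(the brick zones are frozen, so the `Sq_n` side collapses to `x^{u₀}` while the `D_n` side keeps every
triangular edge inside the zones), then the face engine on the block `[2, m-2) × [m+4, 2m)` of the first
zone. [cite: Valiant1980, §3 Thm 1] [cite: JuknaSeiwertSergeev2022, Lemma 2] -/
theorem sq_partner_lower_bound : ∃ κ : ℕ, ∀ (n m : ℕ), Even n → m % 4 = 0 → 68 ≤ m → 3 * m + 4 ≤ n →
    ∀ L : ℕ, 24 * L + 60 ≤ m - 4 →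
      Tfib ^ L ≤ 4 * ((n * n + 2) * (complexity (triPM n * sqPM n) + 3)) ^ κ *
        ((m - 4) * (m - 4) + 1) ^ 2 * (Tfib - 1) ^ L := by
  obtain ⟨κ, hκ⟩ := stub_faceEngine
  refine ⟨κ, fun n m hn hm4 h68 hnm L hL => ?_⟩
  have hme : Even m := Nat.even_iff.2 (by omega)
  have hbe : Even (m + 2) := Nat.even_iff.2 (by omega)
  have hnb : (m + 2) + 2 * m + 2 ≤ n := by omega
  obtain ⟨hu0, hval⟩ := stub_u0_isSqDimer n m (m + 2) hn hme hbe (by omega) le_rfl hnb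
  have hbrick := u0_eq_brick_of_agree (n := n) hval
  have huniq := stub_brickZone_unique n m (m + 2) hme hbe le_rfl hnb hbrick
  obtain ⟨hblk, g, hg⟩ := stub_ringCover n m (m + 2) hn hm4 hbe (by omega) le_rfl hnb hu0 hval
  have hu0mem : u0 m (m + 2) ∈ sqDimers n := (mem_sqDimers_iff _).2 hu0
  have hinside : ∀ v : Vtx n, E0sq m (m + 2) v (u0 m (m + 2) v) := fun v => Or.inr rfl
  have htopD : Negative.topComponent (wInd (E0sq m (m + 2))) (triPM n) = triPMIn (E0sq m (m + 2)) :=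
    stub_topComponent_wInd_triPM n (E0sq m (m + 2))
      ⟨u0 m (m + 2), sqDimers_subset_dimers hu0mem, hinside⟩
  have htopS : Negative.topComponent (wInd (E0sq m (m + 2))) (sqPM n) = sqPMIn (E0sq m (m + 2)) :=
    stub_topComponent_wInd_sqPM n (E0sq m (m + 2)) ⟨u0 m (m + 2), hu0mem, hinside⟩
  have hmono : sqPMIn (E0sq m (m + 2)) = monomial (dimerExp (u0 (n := n) m (m + 2))) 1 := by
    refine stub_sqPMIn_eq_monomial n (E0sq m (m + 2)) (u0 m (m + 2)) hu0mem hinside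
      fun f hf hfin => ?_
    refine huniq f ((mem_sqDimers_iff f).1 hf) fun v => ?_
    rcases hfin v with ⟨k, hk1, hk2, -⟩ | h
    · exact Or.inl ⟨k, hk1, hk2, (((mem_sqDimers_iff f).1 hf) v).2.2⟩
    · exact Or.inr h
  have htop : Negative.topComponent (wInd (E0sq m (m + 2))) (triPM n * sqPM n) =
      triPMIn (E0sq m (m + 2)) * monomial (dimerExp (u0 (n := n) m (m + 2))) 1 := by
    rw [Negative.topComponent_mul, htopD, htopS, hmono]
  have hcx : complexity (triPMIn (E0sq m (m + 2)) * monomial (dimerExp (u0 (n := n) m (m + 2))) 1) ≤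
      complexity (triPM n * sqPM n) := by
    rw [← htop]; exact Negative.complexity_topComponent_le _ _
  have hme4 : Even (m - 4) := Nat.even_iff.2 (by omega)
  have key := hκ n (E0sq m (m + 2)) (dimerExp (u0 (n := n) m (m + 2))) 1 one_ne_zero 2 (m + 2 + 2)
    (m - 4) (by omega) hme4 (by omega) (by omega) hblk ⟨g, hg⟩ L hL
  calc Tfib ^ L ≤ 4 * ((n * n + 2) * (complexity (triPMIn (E0sq m (m + 2)) *
        monomial (dimerExp (u0 (n := n) m (m + 2))) 1) + 3)) ^ κ * ((m - 4) * (m - 4) + 1) ^ 2 *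
        (Tfib - 1) ^ L := key
    _ ≤ 4 * ((n * n + 2) * (complexity (triPM n * sqPM n) + 3)) ^ κ *
        ((m - 4) * (m - 4) + 1) ^ 2 * (Tfib - 1) ^ L := by
      gcongr

/-- **`L₊(D_n · Sq_n)` is not quasi-polynomial** (asymptotic form of rung E-I; answers lead c12's
disprover-wanted "MM at `D_n` for `X = Sq_n`"): no constant `c` has `L₊(D_n · Sq_n) ≤ 2^((log₂ n + c)^c)`
for every `n`.  At the level `n = 2^(j+2)` take zone height `m = 2^j + 4` (block side `2^j`); the
engine's quantity is `≤ 2^((j + c')^c')` with `c' = c + 9 + 2κ`, and `key_ineq_of_bound` /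
`exists_m_violating` (crux-4 toolkit) give the contradiction. [cite: Valiant1980, §3 Thm 1]
[cite: JuknaSeiwertSergeev2022, Lemma 2] -/
theorem not_qp_complexity_triPM_mul_sqPM :
    ¬ ∃ c : ℕ, ∀ n : ℕ, complexity (triPM n * sqPM n) ≤ bound c n := by
  rintro ⟨c, H⟩
  obtain ⟨κ, hκ⟩ := sq_partner_lower_bound
  obtain ⟨j, hj6, hviol⟩ := exists_m_violating (c + 9 + 2 * κ)
  have h64 : 64 ≤ 2 ^ j := by
    calc 64 = 2 ^ 6 := by norm_num
      _ ≤ 2 ^ j := Nat.pow_le_pow_right (by norm_num) hj6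
  have h4 : 2 ^ j % 4 = 0 := by
    have : 2 ^ j = 2 ^ (j - 2) * 4 := by
      rw [show (4 : ℕ) = 2 ^ 2 by norm_num, ← pow_add]; congr 1; omega
    rw [this]; exact Nat.mul_mod_left _ _
  have hn : Even (2 ^ (j + 2)) := Nat.even_pow.2 ⟨even_two, by omega⟩
  have hpow : 2 ^ (j + 2) = 4 * 2 ^ j := by rw [pow_add]; ring
  have hlb : ∀ L, 24 * L + 60 ≤ 2 ^ j →
      Tfib ^ L ≤ 4 * ((2 ^ (j + 2) * 2 ^ (j + 2) + 2) *
        (complexity (triPM (2 ^ (j + 2)) * sqPM (2 ^ (j + 2))) + 3)) ^ κ *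
        (2 ^ j * 2 ^ j + 1) ^ 2 * (Tfib - 1) ^ L := by
    intro L hL
    have key := hκ (2 ^ (j + 2)) (2 ^ j + 4) hn (by omega) (by omega) (by omega) L (by omega)
    have e : 2 ^ j + 4 - 4 = 2 ^ j := by omega
    rw [e] at key
    exact key
  have hF := engine_quantity_le (κ := κ) (H (2 ^ (j + 2)))
  have hkey := key_ineq_of_bound hj6 hlb hF
  exact absurd (hkey.trans_lt hviol) (lt_irrefl _)

end Summit.ValiantsHypothesis.ValiantsHypothesis.Theorems.DivisionGapZeroOneTransfer

end
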